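import Summits.CriticalPhenomena.PercolationContinuityZ3.Theses.PercNearOneGluing
import Summits.CriticalPhenomena.PercolationContinuityZ3.Theorems.PercNearOneGluingAdditiveGluingBlockGrowth
import Summits.CriticalPhenomena.PercolationContinuityZ3.Theorems.PercNearOneGluingAdditiveGluingOffObserverFibres
import HarnessLib

/-! # Crux `PercNearOneGluing.AdditiveGluing` (stmt-CriticalPhenomena-4576), line `peel`, stub `stub_peel` —
# the GLUING TRANSFER: the block step `T → T ∪ {x}` is the pair step `{s} → {s, x}` in the glued weighting `u/T`

**Part 1/2 (this file): clique combinatorics, push-forward bookkeeping and the six block ↔ point identifications (registered stub `stub_peelGluePairGain_v22472`).  Part 2/2 = `…PeelOfPairForm.lean` (`peel_of_pairForm`, `stub_peel_of_gluedPairForm`, `peel_oneRelay`).**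

TTRL deep seat `prover-ttrlatt-v22472-d0-0` (variant V22472 = the registered stub `stub_peel` itself); lands
`--supports stmt-CriticalPhenomena-4576`.  No definitions, no named facts.

Write `u/T` for the weighting `u` with every pair inside the block `T` given weight `1` (Kozma–Nitzan's gluing as
"probability 1", `stub_gluePushforward`), and fix `s ∈ T`.  Under `u/T` the block `T` is almost surely an open clique, so
every BLOCK functional of `T` (reach `μ(T ↔ z)`, designated gain `μ(a₀↔b) + μ(a₀↮b, a₀↔T, T↔b)`, block-cluster law
`μ(K_T = W)`) computed in `u` equals the corresponding POINT functional of `s` computed in `u/T`, the block functionals of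
`T ∪ {x}` in `u` equal those of the pair `{s, x}` in `u/T`, and the pocket factors `min_A μ(a ↔ b in Wᶜ)` agree for every
pocket `W ⊇ T` (the only pockets of positive mass).  Consequently (`peel_of_pairForm`) the conclusion of `stub_peel` for
`(u, T, x)` is LITERALLY the conclusion of the pair stub `stub_ratioMonotonePair` for `(u/T, S = {s, x}, s)`: the block step
needs no new correlation inequality beyond the pair step — only its HYPOTHESES differ (the designation `a₀` is the minimiser of
the un-glued `u`, and `x` need not be bad), which is recorded precisely in `stub_peel_of_gluedPairForm`.
[cite: KozmaNitzan2024, §3.1 Remark p. 5 (gluing), §3.2 pp. 12–14]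
-/

namespace Summit.CriticalPhenomena.PercolationContinuityZ3.Theorems

open MeasureTheory Set
open Literature.Probability.LatticeModels (prodBernoulli)
open Literature.Probability.Percolation (BondConfig openConn openConnIn openGraph openCluster)
open scoped BigOperators

noncomputable section
open Classical

section PeelGlueTransfer

open Literature.Probability.LatticeModels Literature.Probability.Percolation

variable {n : ℕ}

/-! ### Clique combinatorics: on configurations containing all pairs inside `T`, the block `T` behaves as the point `s ∈ T` -/

/-- If every non-loop pair inside `T` is open, two vertices of `T` are connected. [folklore] -/
theorem peelGlue_clique_conn {T : Finset (Fin n)} {ω : BondConfig (Fin n)}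
    (hω : {e : Sym2 (Fin n) | (∀ z ∈ e, z ∈ T) ∧ ¬ e.IsDiag} ⊆ ω) {s t : Fin n} (hs : s ∈ T) (ht : t ∈ T) :
    ω ∈ openConn s t := by
  by_cases hst : s = t
  · subst hst
    exact SimpleGraph.Reachable.refl _
  · refine SimpleGraph.Adj.reachable ?_
    rw [openGraph_adj]
    refine ⟨hω ?_, hst⟩
    refine ⟨?_, ?_⟩
    · intro z hz
      rcases Sym2.mem_iff.1 hz with rfl | rfl
      · exact hs
      · exact ht
    · rw [Sym2.mk_isDiag_iff]
      exact hst

/-- On `T`-cliques the block's reach of `z` is the reach of `z` from the point `s ∈ T`. [folklore] -/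
theorem peelGlue_clique_iUnion_iff {T : Finset (Fin n)} {ω : BondConfig (Fin n)}
    (hω : {e : Sym2 (Fin n) | (∀ z ∈ e, z ∈ T) ∧ ¬ e.IsDiag} ⊆ ω) {s : Fin n} (hs : s ∈ T) (z : Fin n) :
    (ω ∈ ⋃ t ∈ T, openConn t z) ↔ ω ∈ openConn s z := by
  simp only [Set.mem_iUnion, exists_prop]
  constructor
  · rintro ⟨t, ht, htz⟩
    exact blockGrowth_openConn_trans (peelGlue_clique_conn hω hs ht) htz
  · intro h
    exact ⟨s, hs, h⟩

/-- On `T`-cliques, reaching the block from `a` is reaching the point `s ∈ T` from `a`. [folklore] -/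
theorem peelGlue_clique_iUnion_left_iff {T : Finset (Fin n)} {ω : BondConfig (Fin n)}
    (hω : {e : Sym2 (Fin n) | (∀ z ∈ e, z ∈ T) ∧ ¬ e.IsDiag} ⊆ ω) {s : Fin n} (hs : s ∈ T) (a : Fin n) :
    (ω ∈ ⋃ t ∈ T, openConn a t) ↔ ω ∈ openConn a s := by
  simp only [Set.mem_iUnion, exists_prop]
  constructor
  · rintro ⟨t, ht, hat⟩
    exact blockGrowth_openConn_trans hat (peelGlue_clique_conn hω ht hs)
  · intro h
    exact ⟨s, hs, h⟩

/-- On `T`-cliques the reach of `z` from the grown block `T ∪ {x}` is the reach of `z` from the pair `{s, x}`. [folklore] -/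
theorem peelGlue_clique_iUnion_insert_iff {T : Finset (Fin n)} {ω : BondConfig (Fin n)}
    (hω : {e : Sym2 (Fin n) | (∀ z ∈ e, z ∈ T) ∧ ¬ e.IsDiag} ⊆ ω) {s : Fin n} (hs : s ∈ T) (x z : Fin n) :
    (ω ∈ ⋃ v ∈ insert x T, openConn v z) ↔ ω ∈ ⋃ v ∈ ({s, x} : Finset (Fin n)), openConn v z := by
  simp only [Set.mem_iUnion, exists_prop, Finset.mem_insert, Finset.mem_singleton]
  constructor
  · rintro ⟨v, hv | hv, hvz⟩
    · exact ⟨x, Or.inr rfl, hv ▸ hvz⟩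
    · exact ⟨s, Or.inl rfl, blockGrowth_openConn_trans (peelGlue_clique_conn hω hs hv) hvz⟩
  · rintro ⟨v, hv | hv, hvz⟩
    · exact ⟨s, Or.inr hs, hv ▸ hvz⟩
    · exact ⟨x, Or.inl rfl, hv ▸ hvz⟩

/-- On `T`-cliques, reaching the grown block `T ∪ {x}` from `a` is reaching the pair `{s, x}` from `a`. [folklore] -/
theorem peelGlue_clique_iUnion_insert_left_iff {T : Finset (Fin n)} {ω : BondConfig (Fin n)}
    (hω : {e : Sym2 (Fin n) | (∀ z ∈ e, z ∈ T) ∧ ¬ e.IsDiag} ⊆ ω) {s : Fin n} (hs : s ∈ T) (x a : Fin n) :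
    (ω ∈ ⋃ v ∈ insert x T, openConn a v) ↔ ω ∈ ⋃ v ∈ ({s, x} : Finset (Fin n)), openConn a v := by
  simp only [Set.mem_iUnion, exists_prop, Finset.mem_insert, Finset.mem_singleton]
  constructor
  · rintro ⟨v, hv | hv, hav⟩
    · exact ⟨x, Or.inr rfl, hv ▸ hav⟩
    · exact ⟨s, Or.inl rfl, blockGrowth_openConn_trans hav (peelGlue_clique_conn hω hv hs)⟩
  · rintro ⟨v, hv | hv, hav⟩
    · exact ⟨s, Or.inr hs, hv ▸ hav⟩
    · exact ⟨x, Or.inl rfl, hv ▸ hav⟩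

/-- On `T`-cliques the vertex cluster of `s ∈ T` is `W` iff the block cluster `K_T` is `W`. [folklore] -/
theorem peelGlue_clique_cluster_iff {T : Finset (Fin n)} {ω : BondConfig (Fin n)}
    (hω : {e : Sym2 (Fin n) | (∀ z ∈ e, z ∈ T) ∧ ¬ e.IsDiag} ⊆ ω) {s : Fin n} (hs : s ∈ T) (W : Finset (Fin n)) :
    openCluster ω s = (W : Set (Fin n)) ↔ ∀ z : Fin n, (z ∈ W ↔ ω ∈ ⋃ t ∈ T, openConn t z) := by
  constructor
  · intro h z
    rw [peelGlue_clique_iUnion_iff hω hs z, ← Finset.mem_coe, ← h]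
    rfl
  · intro h
    ext z
    rw [Finset.mem_coe, h z, peelGlue_clique_iUnion_iff hω hs z]
    rfl

/-! ### Gluing `T`: push-forward bookkeeping (`stub_gluePushforward`, `stub_glueReach`) -/

/-- **Events that agree on `T`-cliques have the same `u/T`-mass** (the glued law is carried by `T`-cliques). [folklore] -/
theorem peelGlue_real_congr (u : Sym2 (Fin n) → unitInterval) (T : Finset (Fin n))
    {E E' : Set (BondConfig (Fin n))}
    (h : ∀ ω : BondConfig (Fin n), {e : Sym2 (Fin n) | (∀ z ∈ e, z ∈ T) ∧ ¬ e.IsDiag} ⊆ ω → (ω ∈ E ↔ ω ∈ E')) :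
    (prodBernoulli (fun e : Sym2 (Fin n) => if (∀ z ∈ e, z ∈ T) ∧ ¬ e.IsDiag then 1 else u e)).real E =
      (prodBernoulli (fun e : Sym2 (Fin n) => if (∀ z ∈ e, z ∈ T) ∧ ¬ e.IsDiag then 1 else u e)).real E' := by
  rw [stub_gluePushforward n u T E, stub_gluePushforward n u T E']
  congr 1
  ext ω
  exact h _ Set.subset_union_right

/-- Preimage under gluing `T` of the reach of `z` from a super-block `S' ⊇ T`: unchanged. [folklore] -/
theorem peelGlue_preimage_iUnion_superset (T S' : Finset (Fin n)) (hTS' : T ⊆ S') (z : Fin n) :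
    {ω : BondConfig (Fin n) | (ω ∪ {e | (∀ y ∈ e, y ∈ T) ∧ ¬ e.IsDiag}) ∈ ⋃ v ∈ S', openConn v z} =
      ⋃ v ∈ S', openConn v z := by
  ext ω
  simp only [Set.mem_setOf_eq, Set.mem_iUnion, exists_prop]
  constructor
  · rintro ⟨v, hv, h⟩
    rcases (stub_glueReach n T ω v z).1 h with h | ⟨-, t, ht, h'⟩
    · exact ⟨v, hv, h⟩
    · exact ⟨t, hTS' ht, h'⟩
  · rintro ⟨v, hv, h⟩
    exact ⟨v, hv, (stub_glueReach n T ω v z).2 (Or.inl h)⟩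

/-- The reach of `z` from a super-block `S' ⊇ T` has the same mass under `u/T` and `u`. [folklore] -/
theorem peelGlue_real_iUnion_superset (u : Sym2 (Fin n) → unitInterval) (T S' : Finset (Fin n)) (hTS' : T ⊆ S')
    (z : Fin n) :
    (prodBernoulli (fun e : Sym2 (Fin n) => if (∀ y ∈ e, y ∈ T) ∧ ¬ e.IsDiag then 1 else u e)).real
        (⋃ v ∈ S', openConn v z) = (prodBernoulli u).real (⋃ v ∈ S', openConn v z) := by
  rw [stub_gluePushforward n u T, peelGlue_preimage_iUnion_superset T S' hTS' z]

/-- The block-cluster law of a super-block `S' ⊇ T` is the same under `u/T` and `u`. [folklore] -/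
theorem peelGlue_real_pocket_superset (u : Sym2 (Fin n) → unitInterval) (T S' W : Finset (Fin n)) (hTS' : T ⊆ S') :
    (prodBernoulli (fun e : Sym2 (Fin n) => if (∀ y ∈ e, y ∈ T) ∧ ¬ e.IsDiag then 1 else u e)).real
        {ω : BondConfig (Fin n) | ∀ z : Fin n, (z ∈ W ↔ ω ∈ ⋃ v ∈ S', openConn v z)} =
      (prodBernoulli u).real {ω : BondConfig (Fin n) | ∀ z : Fin n, (z ∈ W ↔ ω ∈ ⋃ v ∈ S', openConn v z)} := by
  rw [stub_gluePushforward n u T]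
  congr 1
  ext ω
  simp only [Set.mem_setOf_eq]
  refine forall_congr' fun z => ?_
  have h := Set.ext_iff.1 (peelGlue_preimage_iUnion_superset T S' hTS' z) ω
  rw [Set.mem_setOf_eq] at h
  rw [h]

/-- **The pocket factor does not see the glued pairs**: for a pocket `W ⊇ T`, `μ_{u/T}(a ↔ b in Wᶜ) = μ_u(a ↔ b in Wᶜ)`
(the event is determined by the pairs avoiding `W`, on which `ω ∪ D_T` and `ω` agree). [folklore] -/
theorem peelGlue_real_factor (u : Sym2 (Fin n) → unitInterval) (T W : Finset (Fin n)) (hTW : T ⊆ W) (a b : Fin n) :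
    (prodBernoulli (fun e : Sym2 (Fin n) => if (∀ y ∈ e, y ∈ T) ∧ ¬ e.IsDiag then 1 else u e)).real
        (openConnIn ((W : Set (Fin n))ᶜ) a b) = (prodBernoulli u).real (openConnIn ((W : Set (Fin n))ᶜ) a b) := by
  rw [stub_gluePushforward n u T]
  congr 1
  ext ω
  simp only [Set.mem_setOf_eq]
  have hdet := (determinedBy_iff _ _).1 (offObs_determinedBy_openConnIn_compl W a b)
  refine hdet _ _ ?_
  ext e
  simp only [Set.mem_inter_iff, Set.mem_union, Set.mem_setOf_eq, Finset.coe_filter, Finset.mem_univ, true_and]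
  constructor
  · rintro ⟨he | ⟨hin, -⟩, havoid⟩
    · exact ⟨he, havoid⟩
    · exfalso
      obtain ⟨y, hy⟩ : ∃ y, y ∈ e := ⟨e.out.1, Sym2.out_fst_mem e⟩
      exact havoid y hy (hTW (hin y hy))
  · rintro ⟨he, havoid⟩
    exact ⟨Or.inl he, havoid⟩

/-- A block-cluster event `{K_{S'} = W}` with `T ⊆ S'` but `T ⊄ W` is EMPTY (every vertex of the block lies in its
cluster). [folklore] -/
theorem peelGlue_pocket_eq_empty (T S' W : Finset (Fin n)) (hTS' : T ⊆ S') (hTW : ¬ T ⊆ W) :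
    {ω : BondConfig (Fin n) | ∀ z : Fin n, (z ∈ W ↔ ω ∈ ⋃ v ∈ S', openConn v z)} = ∅ := by
  refine Set.eq_empty_of_forall_notMem fun ω hω => hTW fun t ht => ?_
  refine (hω t).2 ?_
  simp only [Set.mem_iUnion, exists_prop]
  exact ⟨t, hTS' ht, SimpleGraph.Reachable.refl _⟩

/-- Gluing `T ∪ {x}` on top of `u/T` is gluing `T ∪ {x}` on `u` (as weightings). [folklore] -/
theorem peelGlue_glue_insert (u : Sym2 (Fin n) → unitInterval) (T : Finset (Fin n)) (x : Fin n) :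
    (fun e : Sym2 (Fin n) => if (∀ y ∈ e, y ∈ insert x T) ∧ ¬ e.IsDiag then (1 : unitInterval) else
        (if (∀ y ∈ e, y ∈ T) ∧ ¬ e.IsDiag then (1 : unitInterval) else u e)) =
      (fun e : Sym2 (Fin n) => if (∀ y ∈ e, y ∈ insert x T) ∧ ¬ e.IsDiag then (1 : unitInterval) else u e) := by
  funext e
  by_cases h1 : (∀ y ∈ e, y ∈ insert x T) ∧ ¬ e.IsDiag
  · rw [if_pos h1, if_pos h1]
  · rw [if_neg h1, if_neg h1, if_neg]
    rintro ⟨hin, hd⟩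
    exact h1 ⟨fun y hy => Finset.mem_insert_of_mem (hin y hy), hd⟩

/-! ### The six identifications `u`-block ↔ `u/T`-point -/

/-- (E2) `μ_{u/T}(s ↔ b) = μ_u(T ↔ b)` for `s ∈ T`. [cite: KozmaNitzan2024, §3.1 Remark p. 5] -/
theorem peelGlue_real_point_reach (u : Sym2 (Fin n) → unitInterval) (T : Finset (Fin n)) {s : Fin n} (hs : s ∈ T)
    (b : Fin n) :
    (prodBernoulli (fun e : Sym2 (Fin n) => if (∀ y ∈ e, y ∈ T) ∧ ¬ e.IsDiag then 1 else u e)).real (openConn s b) =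
      (prodBernoulli u).real (⋃ v ∈ T, openConn v b) := by
  rw [← blockGrowth_glue_real_iUnion u T b]
  exact peelGlue_real_congr u T fun ω hω => (peelGlue_clique_iUnion_iff hω hs b).symm

/-- (E5) `μ_{u/T}({s, x} ↔ b) = μ_u(T ∪ {x} ↔ b)` for `s ∈ T`. [cite: KozmaNitzan2024, §3.1 Remark p. 5] -/
theorem peelGlue_real_pair_reach (u : Sym2 (Fin n) → unitInterval) (T : Finset (Fin n)) {s : Fin n} (hs : s ∈ T)
    (x b : Fin n) :
    (prodBernoulli (fun e : Sym2 (Fin n) => if (∀ y ∈ e, y ∈ T) ∧ ¬ e.IsDiag then 1 else u e)).real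
        (⋃ v ∈ ({s, x} : Finset (Fin n)), openConn v b) = (prodBernoulli u).real (⋃ v ∈ insert x T, openConn v b) := by
  rw [← peelGlue_real_iUnion_superset u T (insert x T) (Finset.subset_insert x T) b]
  exact peelGlue_real_congr u T fun ω hω => (peelGlue_clique_iUnion_insert_iff hω hs x b).symm

/-- (E3, cluster part) `μ_{u/T}(C(s) = W) = μ_u(K_T = W)` for `s ∈ T`. [cite: KozmaNitzan2024, §3.1 Remark p. 5] -/
theorem peelGlue_real_point_cluster (u : Sym2 (Fin n) → unitInterval) (T : Finset (Fin n)) {s : Fin n} (hs : s ∈ T)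
    (W : Finset (Fin n)) :
    (prodBernoulli (fun e : Sym2 (Fin n) => if (∀ y ∈ e, y ∈ T) ∧ ¬ e.IsDiag then 1 else u e)).real
        {ω : BondConfig (Fin n) | openCluster ω s = (W : Set (Fin n))} =
      (prodBernoulli u).real {ω : BondConfig (Fin n) | ∀ z : Fin n, (z ∈ W ↔ ω ∈ ⋃ v ∈ T, openConn v z)} := by
  rw [← blockGrowth_glue_real_pocket u T W]
  exact peelGlue_real_congr u T fun ω hω => peelGlue_clique_cluster_iff hω hs W

/-- (E4, cluster part) `μ_{u/T}(K_{{s,x}} = W) = μ_u(K_{T ∪ x} = W)` for `s ∈ T`. [cite: KozmaNitzan2024, §3.1 Remark p. 5] -/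
theorem peelGlue_real_pair_cluster (u : Sym2 (Fin n) → unitInterval) (T : Finset (Fin n)) {s : Fin n} (hs : s ∈ T)
    (x : Fin n) (W : Finset (Fin n)) :
    (prodBernoulli (fun e : Sym2 (Fin n) => if (∀ y ∈ e, y ∈ T) ∧ ¬ e.IsDiag then 1 else u e)).real
        {ω : BondConfig (Fin n) | ∀ z : Fin n, (z ∈ W ↔ ω ∈ ⋃ v ∈ ({s, x} : Finset (Fin n)), openConn v z)} =
      (prodBernoulli u).real {ω : BondConfig (Fin n) | ∀ z : Fin n, (z ∈ W ↔ ω ∈ ⋃ v ∈ insert x T, openConn v z)} := by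
  rw [← peelGlue_real_pocket_superset u T (insert x T) W (Finset.subset_insert x T)]
  refine peelGlue_real_congr u T fun ω hω => ?_
  simp only [Set.mem_setOf_eq]
  refine forall_congr' fun z => ?_
  rw [peelGlue_clique_iUnion_insert_iff hω hs x z]

/-- (E6) the designated gain of the pair `{s, x}` in `u/T` is the designated gain of the block `T ∪ {x}` in `u`:
`μ_{u/T}(a₀↔b) + μ_{u/T}(a₀↮b, a₀↔{s,x}, {s,x}↔b) = μ_u(a₀↔b) + μ_u(a₀↮b, a₀↔T∪x, T∪x↔b)`.
[cite: KozmaNitzan2024, §3.1 Remark p. 5] -/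
theorem peelGlue_real_pair_gain (u : Sym2 (Fin n) → unitInterval) (T : Finset (Fin n)) {s : Fin n} (hs : s ∈ T)
    (x a₀ b : Fin n) :
    (prodBernoulli (fun e : Sym2 (Fin n) => if (∀ y ∈ e, y ∈ T) ∧ ¬ e.IsDiag then 1 else u e)).real (openConn a₀ b)
        + (prodBernoulli (fun e : Sym2 (Fin n) => if (∀ y ∈ e, y ∈ T) ∧ ¬ e.IsDiag then 1 else u e)).real
            ((openConn a₀ b)ᶜ ∩ (⋃ v ∈ ({s, x} : Finset (Fin n)), openConn a₀ v)
              ∩ (⋃ v ∈ ({s, x} : Finset (Fin n)), openConn v b)) =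
      (prodBernoulli u).real (openConn a₀ b)
        + (prodBernoulli u).real ((openConn a₀ b)ᶜ ∩ (⋃ v ∈ insert x T, openConn a₀ v) ∩ (⋃ v ∈ insert x T, openConn v b)) := by
  have hE : (prodBernoulli (fun e : Sym2 (Fin n) => if (∀ y ∈ e, y ∈ T) ∧ ¬ e.IsDiag then 1 else u e)).real
      ((openConn a₀ b)ᶜ ∩ (⋃ v ∈ ({s, x} : Finset (Fin n)), openConn a₀ v)
        ∩ (⋃ v ∈ ({s, x} : Finset (Fin n)), openConn v b)) =
      (prodBernoulli (fun e : Sym2 (Fin n) => if (∀ y ∈ e, y ∈ T) ∧ ¬ e.IsDiag then 1 else u e)).real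
      ((openConn a₀ b)ᶜ ∩ (⋃ v ∈ insert x T, openConn a₀ v) ∩ (⋃ v ∈ insert x T, openConn v b)) := by
    refine peelGlue_real_congr u T fun ω hω => ?_
    simp only [Set.mem_inter_iff]
    rw [peelGlue_clique_iUnion_insert_left_iff hω hs x a₀, peelGlue_clique_iUnion_insert_iff hω hs x b]
  rw [hE, ← blockGrowth_glue_real_openConn _ (insert x T) a₀ b, peelGlue_glue_insert u T x,
    blockGrowth_glue_real_openConn u (insert x T) a₀ b]

/-- (E3/E4, whole pocket sums) the dead-pocket mass with worst selection of a super-block `S' ⊇ T`, written with the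
`u/T`-law of a cluster event `P W` that agrees with `μ_u(K_{S'} = W)`, equals the `u`-side pocket sum: the factors agree on
pockets `W ⊇ T` (`peelGlue_real_factor`) and the other pockets are null (`peelGlue_pocket_eq_empty`). [folklore] -/
theorem peelGlue_pocketSum_eq (u : Sym2 (Fin n) → unitInterval) (A T S' : Finset (Fin n)) (hTS' : T ⊆ S') (b : Fin n)
    (hb : b ∈ A) (P : Finset (Fin n) → ℝ)
    (hP : ∀ W, P W = (prodBernoulli u).real {ω : BondConfig (Fin n) | ∀ z : Fin n, (z ∈ W ↔ ω ∈ ⋃ v ∈ S', openConn v z)})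
    (R : Finset (Finset (Fin n))) :
    ∑ W ∈ R, P W * A.inf' ⟨b, hb⟩ (fun a =>
        (prodBernoulli (fun e : Sym2 (Fin n) => if (∀ y ∈ e, y ∈ T) ∧ ¬ e.IsDiag then 1 else u e)).real
          (openConnIn ((W : Set (Fin n))ᶜ) a b)) =
      ∑ W ∈ R, (prodBernoulli u).real {ω : BondConfig (Fin n) | ∀ z : Fin n, (z ∈ W ↔ ω ∈ ⋃ v ∈ S', openConn v z)}
        * A.inf' ⟨b, hb⟩ (fun a => (prodBernoulli u).real (openConnIn ((W : Set (Fin n))ᶜ) a b)) := by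
  refine Finset.sum_congr rfl fun W _ => ?_
  rw [hP W]
  by_cases hTW : T ⊆ W
  · have hf : (fun a => (prodBernoulli (fun e : Sym2 (Fin n) => if (∀ y ∈ e, y ∈ T) ∧ ¬ e.IsDiag then 1 else u e)).real
          (openConnIn ((W : Set (Fin n))ᶜ) a b)) = fun a => (prodBernoulli u).real (openConnIn ((W : Set (Fin n))ᶜ) a b) :=
      funext fun a => peelGlue_real_factor u T W hTW a b
    rw [hf]
  · rw [peelGlue_pocket_eq_empty T S' W hTS' hTW, measureReal_empty, zero_mul, zero_mul]


/-- Registered helper stub `stub_peelGluePairGain_v22472` of crux stmt-CriticalPhenomena-4576 (TTRL deep seat on `stub_peel`):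
the universal closure of `peelGlue_real_pair_gain` — the designated gain of the pair `{s, x}` in the glued weighting `u/T`
is the designated gain of the grown block `T ∪ {x}` in `u`. [cite: KozmaNitzan2024, §3.1 Remark p. 5] -/
theorem stub_peelGluePairGain_v22472 : ∀ (n : ℕ) (u : Sym2 (Fin n) → unitInterval) (T : Finset (Fin n)) (s x a₀ b : Fin n), s ∈ T → (Literature.Probability.LatticeModels.prodBernoulli (fun e : Sym2 (Fin n) => if (∀ y ∈ e, y ∈ T) ∧ ¬ e.IsDiag then 1 else u e)).real (Literature.Probability.Percolation.openConn a₀ b) + (Literature.Probability.LatticeModels.prodBernoulli (fun e : Sym2 (Fin n) => if (∀ y ∈ e, y ∈ T) ∧ ¬ e.IsDiag then 1 else u e)).real ((Literature.Probability.Percolation.openConn a₀ b)ᶜ ∩ (⋃ v ∈ ({s, x} : Finset (Fin n)), Literature.Probability.Percolation.openConn a₀ v) ∩ (⋃ v ∈ ({s, x} : Finset (Fin n)), Literature.Probability.Percolation.openConn v b)) = (Literature.Probability.LatticeModels.prodBernoulli u).real (Literature.Probability.Percolation.openConn a₀ b) + (Literature.Probability.LatticeModels.prodBernoulli u).real ((Literature.Probability.Percolation.openConn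 a₀ b)ᶜ ∩ (⋃ v ∈ insert x T, Literature.Probability.Percolation.openConn a₀ v) ∩ (⋃ v ∈ insert x T, Literature.Probability.Percolation.openConn v b)) :=
  fun _ u T _ x a₀ b hs => peelGlue_real_pair_gain u T hs x a₀ b

end PeelGlueTransfer

end

end Summit.CriticalPhenomena.PercolationContinuityZ3.Theorems
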